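import Summits.KontsevichZagierPeriods.KontsevichZagierPeriods.Theses.TerasomaMultiplication
import Literature.NumberTheory.Transcendental.KZDominatedFamilyRelations
import Literature.NumberTheory.Transcendental.KZMellinFibres
import Literature.NumberTheory.Transcendental.SemialgebraicLineDeriv
import Literature.NumberTheory.Transcendental.SemialgebraicDerivativeProofs
import Summits.KontsevichZagierPeriods.KontsevichZagierPeriods.Theorems.HermiteRigidityGenusTwoCycleTransferPushforwardDimOne

/-!
# `DasGapTwelve` (stmt-KontsevichZagierPeriods-13215, route TerasomaMultiplication), line
`picard-involution-quotient`: stub B, the lemniscatic normalisation of `B(1/4,1/4)`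

For every pinned representation `r' = [(0,1), C·t^(−3/4)(1−t)^(−3/4)]`
(`C = 2^(−1/4)·3^(3/8)·√(1+√3)`) and every pinned `ρ₄ = [(0,1), 4√2·C·(1 − s⁴)^(−1/2)]` we show
`KZ.Equivalent r' ρ₄` by four moves of the Kontsevich–Zagier calculus in dimension one:

1. split `(0,1)` at the null point `1/2` (rule 1a; `KZ.IntegralRep.of_sub_of_restrict_mem_relations`
   and one `KZ.domainAddRel` instance);
2. the reflection `t ↦ 1 − t` identifies the right half with the left half (rule 2,
   `KZ.of_sub_of_mem_relations_of_boxReflection`; the Beta integrand is symmetric);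
3. the left half `(0,1/2)` is pushed forward along `φ(t) = (4t(1−t))^(1/4)` onto `(0,1)` (rule 2,
   `stub_pushforwardDimOne`; inverse `ψ(s) = (1 − √(1−s⁴))/2`, `φ′(t) = (1−2t)(4t(1−t))^(−3/4)`,
   pushed integrand `C·t^(−3/4)(1−t)^(−3/4)/φ′(t) = 2√2·C·(1−s⁴)^(−1/2)` since `4^(3/4) = 2√2` and
   `(1−2t)² = 1 − s⁴`);
4. `4√2 = 2√2 + 2√2` is one `KZ.integrandAddRel` instance (rule 1b).

No property of the constant `C` is used.

References: M. Kontsevich, D. Zagier, *Periods* (2001), §1.2 rules (1), (2).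
-/

noncomputable section

open Set MeasureTheory
open Literature.NumberTheory.Transcendental Literature.ModelTheory.ExponentialFields
open Summit.KontsevichZagierPeriods.HermiteRigidity.GenusTwoCycleTransfer (stub_pushforwardDimOne)

namespace Summit.KontsevichZagierPeriods.TerasomaMultiplication.DasGapTwelve

/-! ### Real identities for the substitution `s = (4t(1−t))^(1/4)`, `t = (1 − √(1−s⁴))/2` -/

/-- `4^(−3/4) = 1/(2√2)` (compare fourth powers of the positive reals `4^(3/4)`, `2√2`).
[folklore] -/
theorem four_rpow_neg_three_quarters : (4:ℝ) ^ (-(3:ℝ)/4) = (2 * Real.sqrt 2)⁻¹ := by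
  have hpos : 0 < (4:ℝ) ^ ((3:ℝ)/4) := Real.rpow_pos_of_pos (by norm_num) _
  have key : (4:ℝ) ^ ((3:ℝ)/4) = 2 * Real.sqrt 2 := by
    have hs : Real.sqrt 2 ^ 4 = 4 := by
      rw [show (4:ℕ) = 2 * 2 from rfl, pow_mul, Real.sq_sqrt (by norm_num : (0:ℝ) ≤ 2)]
      norm_num
    have h4 : ((4:ℝ) ^ ((3:ℝ)/4)) ^ 4 = (2 * Real.sqrt 2) ^ 4 := by
      rw [← Real.rpow_natCast, ← Real.rpow_mul (by norm_num : (0:ℝ) ≤ 4),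
        show ((3:ℝ)/4) * ((4:ℕ):ℝ) = ((3:ℕ):ℝ) by norm_num, Real.rpow_natCast, mul_pow, hs]
      norm_num
    exact (pow_left_inj₀ hpos.le (by positivity) (by norm_num : (4:ℕ) ≠ 0)).1 h4
  rw [show (-(3:ℝ)/4) = -((3:ℝ)/4) by ring, Real.rpow_neg (by norm_num : (0:ℝ) ≤ 4), key]

/-- The rule-2 weight of the substitution `s = φ(t) = (4t(1−t))^(1/4)` on `(0,1/2)`:
`K·t^(−3/4)(1−t)^(−3/4) / |φ′(t)| = 2√2·K·(1 − φ(t)⁴)^(−1/2)`. [folklore] -/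
theorem weight_lemniscatic (K t : ℝ) (ht : t ∈ Ioo (0:ℝ) (1/2)) :
    K * t ^ (-(3:ℝ)/4) * (1 - t) ^ (-(3:ℝ)/4) / |(1 - 2 * t) * (4 * t * (1 - t)) ^ (-(3:ℝ)/4)| =
      2 * Real.sqrt 2 * K * (1 - ((4 * t * (1 - t)) ^ ((1:ℝ)/4)) ^ 4) ^ (-(1:ℝ)/2) := by
  obtain ⟨ht0, ht2⟩ := ht
  have ht1 : 0 < 1 - t := by linarith
  have hw : 0 < 1 - 2 * t := by linarith
  have hu : 0 < t * (1 - t) := mul_pos ht0 ht1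
  have hb : 0 < 4 * t * (1 - t) := mul_pos (mul_pos (by norm_num) ht0) ht1
  have e1 : ((4 * t * (1 - t)) ^ ((1:ℝ)/4)) ^ 4 = 4 * t * (1 - t) := by
    rw [show (1:ℝ)/4 = ((4:ℕ):ℝ)⁻¹ by norm_num]
    exact Real.rpow_inv_natCast_pow hb.le (by norm_num)
  have e2 : (1:ℝ) - 4 * t * (1 - t) = (1 - 2 * t) ^ 2 := by ring
  have e3 : ((1 - 2 * t) ^ 2) ^ (-(1:ℝ)/2) = (1 - 2 * t)⁻¹ := by
    rw [← Real.rpow_natCast, ← Real.rpow_mul hw.le,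
      show (((2:ℕ):ℝ)) * (-(1:ℝ)/2) = -1 by norm_num, Real.rpow_neg_one]
  have e4 : t ^ (-(3:ℝ)/4) * (1 - t) ^ (-(3:ℝ)/4) = (t * (1 - t)) ^ (-(3:ℝ)/4) :=
    (Real.mul_rpow ht0.le ht1.le).symm
  have e5 : (4 * t * (1 - t)) ^ (-(3:ℝ)/4) = (2 * Real.sqrt 2)⁻¹ * (t * (1 - t)) ^ (-(3:ℝ)/4) := by
    rw [mul_assoc, Real.mul_rpow (by norm_num : (0:ℝ) ≤ 4) hu.le, four_rpow_neg_three_quarters]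
  have hv : (t * (1 - t)) ^ (-(3:ℝ)/4) ≠ 0 := (Real.rpow_pos_of_pos hu _).ne'
  have hs2 : Real.sqrt 2 ≠ 0 := by positivity
  have hw' : 1 - 2 * t ≠ 0 := hw.ne'
  rw [abs_of_pos (mul_pos hw (Real.rpow_pos_of_pos hb _)), e1, e2, e3, mul_assoc K, e4, e5]
  field_simp

/-- For `s ∈ (0,1)` the point `t = (1 − √(1 − s⁴))/2` lies in `(0, 1/2)`. [folklore] -/
theorem psi_mem {s : ℝ} (hs : s ∈ Ioo (0:ℝ) 1) :
    (1 - Real.sqrt (1 - s ^ 4)) / 2 ∈ Ioo (0:ℝ) (1/2) := by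
  obtain ⟨h0, h1⟩ := hs
  have hw0 : 0 < 1 - s ^ 4 := sub_pos.2 (pow_lt_one₀ h0.le h1 (by norm_num))
  have hw1 : 1 - s ^ 4 < 1 := by have := pow_pos h0 4; linarith
  have hr0 : 0 < Real.sqrt (1 - s ^ 4) := Real.sqrt_pos.2 hw0
  have hr1 : Real.sqrt (1 - s ^ 4) < 1 := (Real.sqrt_lt' one_pos).2 (by rwa [one_pow])
  constructor <;> linarith

/-- For `s ∈ (0,1)` and `t = (1 − √(1 − s⁴))/2`: `4t(1−t) = 1 − (√(1−s⁴))² = s⁴`. [folklore] -/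
theorem four_psi_mul {s : ℝ} (hs : s ∈ Ioo (0:ℝ) 1) :
    4 * ((1 - Real.sqrt (1 - s ^ 4)) / 2) * (1 - (1 - Real.sqrt (1 - s ^ 4)) / 2) = s ^ 4 := by
  have hw0 : 0 ≤ 1 - s ^ 4 := sub_nonneg.2 (pow_le_one₀ hs.1.le hs.2.le)
  linear_combination (-1:ℝ) * Real.sq_sqrt hw0

/-- `φ(ψ(s)) = s` on `(0,1)`: `(s⁴)^(1/4) = s`. [folklore] -/
theorem phi_psi {s : ℝ} (hs : s ∈ Ioo (0:ℝ) 1) :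
    (4 * ((1 - Real.sqrt (1 - s ^ 4)) / 2) * (1 - (1 - Real.sqrt (1 - s ^ 4)) / 2)) ^ ((1:ℝ)/4) =
      s := by
  rw [four_psi_mul hs, show (1:ℝ)/4 = ((4:ℕ):ℝ)⁻¹ by norm_num]
  exact Real.pow_rpow_inv_natCast hs.1.le (by norm_num)

/-- `ψ(φ(t)) = t` on `(0,1/2)`: `1 − 4t(1−t) = (1−2t)²` with `1 − 2t > 0`. [folklore] -/
theorem psi_phi {t : ℝ} (ht : t ∈ Ioo (0:ℝ) (1/2)) :
    (1 - Real.sqrt (1 - ((4 * t * (1 - t)) ^ ((1:ℝ)/4)) ^ 4)) / 2 = t := by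
  obtain ⟨ht0, ht2⟩ := ht
  have hb : 0 ≤ 4 * t * (1 - t) := by nlinarith
  rw [show (1:ℝ)/4 = ((4:ℕ):ℝ)⁻¹ by norm_num, Real.rpow_inv_natCast_pow hb (by norm_num),
    show (1:ℝ) - 4 * t * (1 - t) = (1 - 2 * t) ^ 2 by ring,
    Real.sqrt_sq (by linarith : (0:ℝ) ≤ 1 - 2 * t)]
  ring

/-- `φ′(t) = (1 − 2t)(4t(1−t))^(−3/4)` is the derivative of `φ(t) = (4t(1−t))^(1/4)` at every
`t ∈ (0,1/2)`. [folklore] -/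
theorem hasDerivAt_phi {t : ℝ} (ht : t ∈ Ioo (0:ℝ) (1/2)) :
    HasDerivAt (fun y : ℝ => (4 * y * (1 - y)) ^ ((1:ℝ)/4))
      ((1 - 2 * t) * (4 * t * (1 - t)) ^ (-(3:ℝ)/4)) t := by
  have hb : 0 < 4 * t * (1 - t) := mul_pos (mul_pos (by norm_num) ht.1) (by linarith [ht.2])
  have h1 : HasDerivAt (fun y : ℝ => 4 * y * (1 - y)) (4 * 1 * (1 - t) + 4 * t * (0 - 1)) t :=
    ((hasDerivAt_id' t).const_mul (4:ℝ)).mul ((hasDerivAt_const t (1:ℝ)).sub (hasDerivAt_id' t))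
  refine (h1.rpow_const (p := (1:ℝ)/4) (Or.inl hb.ne')).congr_deriv ?_
  rw [show (1:ℝ)/4 - 1 = -(3:ℝ)/4 by norm_num]
  ring

/-- `φ′ > 0` on `(0, 1/2)`. [folklore] -/
theorem phi'_pos {t : ℝ} (ht : t ∈ Ioo (0:ℝ) (1/2)) :
    0 < (1 - 2 * t) * (4 * t * (1 - t)) ^ (-(3:ℝ)/4) :=
  mul_pos (by linarith [ht.2])
    (Real.rpow_pos_of_pos (mul_pos (mul_pos (by norm_num) ht.1) (by linarith [ht.2])) _)

/-- The image of the cell `{p | p 0 ∈ (0,1/2)}` under `Φ(p) = (φ(p 0))` is `{q | q 0 ∈ (0,1)}`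
(double inclusion with the explicit inverse `ψ`). [folklore] -/
theorem image_phi :
    (fun p : Fin 1 → ℝ => fun _ : Fin 1 => (4 * p 0 * (1 - p 0)) ^ ((1:ℝ)/4)) ''
        {p : Fin 1 → ℝ | p 0 ∈ Ioo (0:ℝ) (1/2)} = {q | q 0 ∈ Ioo (0:ℝ) 1} := by
  ext q
  constructor
  · rintro ⟨p, hp, rfl⟩
    obtain ⟨h0, h2⟩ : 0 < p 0 ∧ p 0 < 1/2 := hp
    have hw : 0 < 1 - 2 * p 0 := by linarith
    have hb : 0 < 4 * p 0 * (1 - p 0) := mul_pos (mul_pos (by norm_num) h0) (by linarith)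
    have hb1 : 4 * p 0 * (1 - p 0) < 1 := by nlinarith [mul_pos hw hw]
    exact ⟨Real.rpow_pos_of_pos hb _, Real.rpow_lt_one hb.le hb1 (by norm_num)⟩
  · intro hq
    have hq' : q 0 ∈ Ioo (0:ℝ) 1 := hq
    refine ⟨fun _ => (1 - Real.sqrt (1 - (q 0) ^ 4)) / 2, psi_mem hq', ?_⟩
    funext i
    rw [Fin.fin_one_eq_zero i]
    exact phi_psi hq'

/-! ### The stub -/

/-- **Stub B** (lemniscatic normalisation of `B(1/4,1/4)`, line `picard-involution-quotient` of
`DasGapTwelve`): split `(0,1)` at `1/2`, fold `t ↦ 1−t`, substitute `s = (4t(1−t))^(1/4)`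
(`t = (1 − √(1−s⁴))/2`, so `t(1−t) = s⁴/4`): the crux's right representation
`[(0,1), C·t^(−3/4)(1−t)^(−3/4)]`, `C = 2^(−1/4)·3^(3/8)·√(1+√3)`, is KZ-equivalent to every
`[(0,1), 4√2·C·(1−s⁴)^(−1/2)]`. [cite: KontsevichZagier2001, §1.2 rule (2)] -/
theorem stub_lemniscaticBeta :
    ∀ (r' : Literature.NumberTheory.Transcendental.KZ.IntegralRep 1), r'.domain = {x | x 0 ∈ Set.Ioo (0:ℝ) 1} → Set.EqOn r'.integrand (fun x => (2:ℝ) ^ (-(1:ℝ)/4) * (3:ℝ) ^ ((3:ℝ)/8) * Real.sqrt (1 + Real.sqrt 3) * (x 0) ^ (-(3:ℝ)/4) * (1 - x 0) ^ (-(3:ℝ)/4)) r'.domain → ∀ (ρ₄ : Literature.NumberTheory.Transcendental.KZ.IntegralRep 1), ρ₄.domain = {x | x 0 ∈ Set.Ioo (0:ℝ) 1} → Set.EqOn ρ₄.integrand (fun x => 4 * Real.sqrt 2 * ((2:ℝ) ^ (-(1:ℝ)/4) * (3:ℝ) ^ ((3:ℝ)/8) * Real.sqrt (1 + Real.sqrt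 3)) * (1 - (x 0) ^ 4) ^ (-(1:ℝ)/2)) ρ₄.domain → Literature.NumberTheory.Transcendental.KZ.Equivalent r' ρ₄ := by
  intro r' hd' hi' ρ₄ hρd hρi
  -- the cells `(0,1)`, `(0,1/2)`, `(1/2,1)` of `ℝ¹`
  have hU : IsSemialgebraic ℚ {q : Fin 1 → ℝ | q 0 ∈ Ioo (0:ℝ) 1} := by
    rw [← hd']; exact r'.isSemialgebraic_domain
  have hA : IsSemialgebraic ℚ {p : Fin 1 → ℝ | p 0 ∈ Ioo (0:ℝ) (1/2)} := by
    have h1 := isSemialgebraic_setOf_eval_pos (k := ℚ) (R := ℝ)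
      (MvPolynomial.X 0 : MvPolynomial (Fin 1) ℚ)
    have h2 := isSemialgebraic_setOf_eval_pos (k := ℚ) (R := ℝ)
      (1 - 2 * MvPolynomial.X 0 : MvPolynomial (Fin 1) ℚ)
    convert h1.inter h2 using 1
    ext p
    simp only [mem_setOf_eq, mem_Ioo, mem_inter_iff, map_sub, map_mul, map_one,
      MvPolynomial.aeval_X, map_ofNat, sub_pos]
    constructor <;> rintro ⟨ha, hb⟩ <;> exact ⟨ha, by linarith⟩
  have hB : IsSemialgebraic ℚ {p : Fin 1 → ℝ | p 0 ∈ Ioo ((1:ℝ)/2) 1} := by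
    have h1 := isSemialgebraic_setOf_eval_pos (k := ℚ) (R := ℝ)
      (2 * MvPolynomial.X 0 - 1 : MvPolynomial (Fin 1) ℚ)
    have h2 := isSemialgebraic_setOf_eval_pos (k := ℚ) (R := ℝ)
      (1 - MvPolynomial.X 0 : MvPolynomial (Fin 1) ℚ)
    convert h1.inter h2 using 1
    ext p
    simp only [mem_setOf_eq, mem_Ioo, mem_inter_iff, map_sub, map_mul, map_one,
      MvPolynomial.aeval_X, map_ofNat, sub_pos]
    constructor <;> rintro ⟨ha, hb⟩ <;> exact ⟨by linarith, by linarith⟩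
  have hAr : {p : Fin 1 → ℝ | p 0 ∈ Ioo (0:ℝ) (1/2)} ⊆ r'.domain := by
    rw [hd']; exact fun p hp => ⟨hp.1, hp.2.trans (by norm_num)⟩
  have hBr : {p : Fin 1 → ℝ | p 0 ∈ Ioo ((1:ℝ)/2) 1} ⊆ r'.domain := by
    rw [hd']; exact fun p hp => ⟨(by norm_num : (0:ℝ) < 1/2).trans hp.1, hp.2⟩
  have hABr : {p : Fin 1 → ℝ | p 0 ∈ Ioo (0:ℝ) (1/2)} ∪ {p | p 0 ∈ Ioo ((1:ℝ)/2) 1} ⊆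
      r'.domain := union_subset hAr hBr
  -- (1) split at the null point `1/2`
  have hnull : volume (r'.domain \
      ({p : Fin 1 → ℝ | p 0 ∈ Ioo (0:ℝ) (1/2)} ∪ {p | p 0 ∈ Ioo ((1:ℝ)/2) 1})) = 0 := by
    refine measure_mono_null (fun x hx => ?_) (KZ.volume_setOf_last_eq_zero (n := 0) ((1:ℝ)/2))
    rw [hd'] at hx
    obtain ⟨⟨h0, h1⟩, hx'⟩ := hx
    rw [mem_setOf_eq, Fin.last_zero]
    by_contra hne
    rcases lt_or_gt_of_ne hne with hlt | hgt
    · exact hx' (Or.inl ⟨h0, hlt⟩)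
    · exact hx' (Or.inr ⟨hgt, h1⟩)
  set R₀ := r'.restrict _ (hA.union hB) hABr with hR₀
  set R₁ := r'.restrict _ hA hAr with hR₁
  set R₂ := r'.restrict _ hB hBr with hR₂
  have h₀ : KZ.of r' - KZ.of R₀ ∈ KZ.relations :=
    r'.of_sub_of_restrict_mem_relations (hA.union hB) hABr hnull
  have h₁ : KZ.of R₀ - KZ.of R₁ - KZ.of R₂ ∈ KZ.relations := by
    refine KZ.domainAddRel_subset_relations
      ⟨1, R₀, R₁, R₂, rfl, ?_, fun _ _ => rfl, fun _ _ => rfl, rfl⟩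
    have : R₁.domain ∩ R₂.domain = ∅ := eq_empty_of_forall_notMem fun x hx => by
      have hx1 : x 0 < 1/2 := hx.1.2
      have hx2 : 1/2 < x 0 := hx.2.1
      linarith
    rw [this, measure_empty]
  -- (2) the reflection `t ↦ 1 − t` carries the right half onto the left half
  have h₂ : KZ.of R₂ - KZ.of R₁ ∈ KZ.relations := by
    refine KZ.of_sub_of_mem_relations_of_boxReflection (0 : Fin 1) ?_ fun x hx => ?_
    · show {p : Fin 1 → ℝ | p 0 ∈ Ioo ((1:ℝ)/2) 1} =
        KZ.boxReflection 0 ⁻¹' {p : Fin 1 → ℝ | p 0 ∈ Ioo (0:ℝ) (1/2)}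
      ext x
      simp only [mem_setOf_eq, mem_preimage, KZ.boxReflection_apply_self, mem_Ioo]
      constructor <;> rintro ⟨ha, hb⟩ <;> constructor <;> linarith
    · have hxB : (1:ℝ)/2 < x 0 ∧ x 0 < 1 := hx
      have hx1 : x ∈ r'.domain := hBr hx
      have hx2 : KZ.boxReflection 0 x ∈ r'.domain := by
        refine hAr ?_
        show KZ.boxReflection 0 x 0 ∈ Ioo (0:ℝ) (1/2)
        rw [KZ.boxReflection_apply_self]
        constructor <;> linarith [hxB.1, hxB.2]
      show r'.integrand x = r'.integrand (KZ.boxReflection 0 x)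
      rw [hi' hx1, hi' hx2]
      simp only [KZ.boxReflection_apply_self, sub_sub_cancel]
      ring
  -- (3) push the left half forward along `φ(t) = (4t(1−t))^(1/4)`
  have hφ : IsSemialgebraicFunOn ℚ {p : Fin 1 → ℝ | p 0 ∈ Ioo (0:ℝ) (1/2)}
      (fun p => (4 * p 0 * (1 - p 0)) ^ ((1:ℝ)/4)) := by
    refine (KZ.isSemialgebraicFunOn_mellinIntegrand hA
      (fun _ : Fin 1 => (4 * MvPolynomial.X 0 * (1 - MvPolynomial.X 0) : MvPolynomial (Fin 1) ℚ))
      (fun _ => (1/4 : ℚ)) 1 (fun p hp _ => ?_)).congr fun p _ => ?_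
    · have h0 : 0 < p 0 := hp.1
      have h2 : p 0 < 1/2 := hp.2
      simp only [map_mul, map_sub, map_one, MvPolynomial.aeval_X, map_ofNat]
      exact mul_pos (mul_pos (by norm_num) h0) (by linarith)
    · simp [KZ.mellinIntegrand]
  have hφ' : IsSemialgebraicFunOn ℚ {p : Fin 1 → ℝ | p 0 ∈ Ioo (0:ℝ) (1/2)}
      (fun p => (1 - 2 * p 0) * (4 * p 0 * (1 - p 0)) ^ (-(3:ℝ)/4)) :=
    IsSemialgebraicFunOn.hasDerivAt_isSemialgebraic_holds 0 (1/2)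
      (fun y => (4 * y * (1 - y)) ^ ((1:ℝ)/4))
      (fun t => (1 - 2 * t) * (4 * t * (1 - t)) ^ (-(3:ℝ)/4)) (by norm_num) hφ
      fun t ht => hasDerivAt_phi ht
  have hψ : IsSemialgebraicFunOn ℚ {q : Fin 1 → ℝ | q 0 ∈ Ioo (0:ℝ) 1}
      (fun q => (1 - Real.sqrt (1 - (q 0) ^ 4)) / 2) := by
    have h1 : IsSemialgebraicFunOn ℚ {q : Fin 1 → ℝ | q 0 ∈ Ioo (0:ℝ) 1} (fun q => 1 - (q 0) ^ 4) :=
      (isSemialgebraicFunOn_aeval hU (1 - MvPolynomial.X 0 ^ 4 : MvPolynomial (Fin 1) ℚ)).congr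
        fun q _ => by simp
    have h2 := isSemialgebraicFunOn_const_ratCast hU (1/2)
    refine (h2.fun_sub (h2.fun_mul h1.fun_sqrt)).congr fun q _ => ?_
    push_cast
    ring
  have hG : IsSemialgebraicMapOn ℚ
      ((fun p : Fin 1 → ℝ => fun _ : Fin 1 => (4 * p 0 * (1 - p 0)) ^ ((1:ℝ)/4)) ''
        {p : Fin 1 → ℝ | p 0 ∈ Ioo (0:ℝ) (1/2)})
      (fun q (_ : Fin 1) => (1 - Real.sqrt (1 - (q 0) ^ 4)) / 2) := by
    rw [image_phi]
    exact IsSemialgebraicMapOn.of_forall hU fun _ => hψ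
  obtain ⟨S, hSd, hSi, hSrel⟩ := stub_pushforwardDimOne R₁
    (fun y => (4 * y * (1 - y)) ^ ((1:ℝ)/4))
    (fun t => (1 - 2 * t) * (4 * t * (1 - t)) ^ (-(3:ℝ)/4))
    (fun q (_ : Fin 1) => (1 - Real.sqrt (1 - (q 0) ^ 4)) / 2) hφ hφ'
    (fun p hp => hasDerivAt_phi (t := p 0) hp) (fun p hp => (phi'_pos (t := p 0) hp).ne') hG
    (fun p hp => funext fun i => by rw [Fin.fin_one_eq_zero i]; exact psi_phi (t := p 0) hp)
  have h₃ : KZ.of R₁ - KZ.of S ∈ KZ.relations := KZ.changeOfVariablesRel_subset_relations hSrel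
  have hSU : S.domain = {q : Fin 1 → ℝ | q 0 ∈ Ioo (0:ℝ) 1} := hSd.trans image_phi
  -- the pushed-forward integrand is `2√2·C·(1 − s⁴)^(−1/2)`
  have hSval : ∀ p : Fin 1 → ℝ, p 0 ∈ Ioo (0:ℝ) (1/2) →
      S.integrand (fun _ => (4 * p 0 * (1 - p 0)) ^ ((1:ℝ)/4)) =
        2 * Real.sqrt 2 * ((2:ℝ) ^ (-(1:ℝ)/4) * (3:ℝ) ^ ((3:ℝ)/8) * Real.sqrt (1 + Real.sqrt 3)) *
          (1 - ((4 * p 0 * (1 - p 0)) ^ ((1:ℝ)/4)) ^ 4) ^ (-(1:ℝ)/2) := fun p hp => by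
    refine (hSi p hp).trans ?_
    show r'.integrand p / |(1 - 2 * p 0) * (4 * p 0 * (1 - p 0)) ^ (-(3:ℝ)/4)| = _
    rw [hi' (hAr hp)]
    exact weight_lemniscatic _ (p 0) hp
  -- (4) `4√2 = 2√2 + 2√2`: one integrand-additivity move
  have hSρ : S.domain = ρ₄.domain := hSU.trans hρd.symm
  have h₄ : KZ.of ρ₄ - KZ.of S - KZ.of S ∈ KZ.relations := by
    refine KZ.integrandAddRel_subset_relations ⟨1, ρ₄, S, S, hSρ, hSρ, fun q hq => ?_, rfl⟩
    have hq' := hq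
    rw [hρd, ← image_phi] at hq'
    obtain ⟨p, hp, rfl⟩ := hq'
    rw [Pi.add_apply, hρi hq, hSval p hp]
    dsimp only
    ring
  -- assemble
  show KZ.of r' - KZ.of ρ₄ ∈ KZ.relations
  have : KZ.of r' - KZ.of ρ₄ = (KZ.of r' - KZ.of R₀) + (KZ.of R₀ - KZ.of R₁ - KZ.of R₂) +
      (KZ.of R₂ - KZ.of R₁) + (KZ.of R₁ - KZ.of S) + (KZ.of R₁ - KZ.of S) -
      (KZ.of ρ₄ - KZ.of S - KZ.of S) := by abel
  rw [this]
  exact KZ.relations.sub_mem (KZ.relations.add_mem (KZ.relations.add_mem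
    (KZ.relations.add_mem (KZ.relations.add_mem h₀ h₁) h₂) h₃) h₃) h₄

end Summit.KontsevichZagierPeriods.TerasomaMultiplication.DasGapTwelve

end
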